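import Literature.Computability.MetaComplexity.PolynomialCalculusSizeDegreeCombine
import HarnessLib

/-!
# Completeness of the multilinear polynomial calculus on Boolean-unsatisfiable axiom sets

Companion of `PolynomialCalculusVariableRule.lean` / `PolynomialCalculusSizeDegreeCombine.lean`:
the polynomial calculus with the variable-multiplication rule in multilinear form
(`MLPC.Derivable`, Clegg–Edmonds–Impagliazzo 1996 / Impagliazzo–Pudlák–Sgall 1999) REFUTES every
set of axioms that has no common Boolean zero — so the size and degree lower bounds proved for it
(`PolynomialCalculusSizeDegree.lean`) quantify over a nonempty set of refutations whenever the
axioms are Boolean-unsatisfiable.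

* `MLPC.boolPoint x` — the `0/1` point of `K^σ` given by `x : σ → Bool`; `MLPC.eval_restrictVar` —
  restriction `x_j := b` is evaluation at the updated point.
* `MLPC.BoolUnsat 𝓕` — no Boolean point is a common zero of `𝓕`; preserved by restriction
  (`BoolUnsat.restrictSet`).
* `MLPC.derivable_one_of_boolUnsat` — COMPLETENESS with a degree bound: if the axioms live on the
  finite variable set `V` and have degree `≤ d₀`, a Boolean-unsatisfiable `𝓕` has a refutation with
  all lines of degree `≤ |V| + d₀` (induction on `V` through the two combination lemmas — the
  textbook completeness argument, Krajíček 2019, Lemma 6.2.1 / Thm. 6.2.2 for PC).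
* `MLPC.Derivable.exists_support_subset` — every derivation uses finitely many monomials: some
  finite `M` contains the monomials of all its lines.

References: M. Clegg, J. Edmonds, R. Impagliazzo, Proc. 28th STOC (1996) 174–183; J. Krajíček,
*Proof Complexity* (CUP 2019), §6.2 (completeness of PC, Lemma 6.2.1) [KrajicekProofComplexity2019].
-/

noncomputable section

namespace Literature.Computability.MetaComplexity

open Finset MvPolynomial

variable {σ : Type*} {K : Type*} [Field K]

namespace MLPC

variable {𝓕 : Set (MvPolynomial σ K)}

/-! ### Boolean points and unsatisfiability -/

variable (K) in
/-- The `0/1` point of `K^σ` determined by a Boolean assignment. [folklore] -/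
def boolPoint (x : σ → Bool) : σ → K := fun i => if x i then 1 else 0

variable (K) in
/-- **Boolean unsatisfiability** of a set of polynomials: no `0/1` point is a common zero.
(For the clause polynomials (6.0.1) of a CNF this is unsatisfiability of the CNF.)
[Krajíček 2019, §6.2] [cite: KrajicekProofComplexity2019, §6.2] -/
def BoolUnsat (𝓕 : Set (MvPolynomial σ K)) : Prop :=
  ∀ x : σ → Bool, ∃ g ∈ 𝓕, eval (boolPoint K x) g ≠ 0

/-- Every derivation uses finitely many monomials. [folklore] -/
theorem Derivable.exists_support_subset [DecidableEq σ] {P : MvPolynomial σ K → Prop}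
    {f : MvPolynomial σ K} (h : Derivable 𝓕 P f) :
    ∃ M : Finset (σ →₀ ℕ), Derivable 𝓕 (fun g => g.support ⊆ M) f := by
  induction h with
  | @hyp g hg _ => exact ⟨(ml K g).support, .hyp hg Finset.Subset.rfl⟩
  | @add f g _ _ _ ihf ihg =>
    obtain ⟨Mf, hf⟩ := ihf
    obtain ⟨Mg, hg⟩ := ihg
    refine ⟨Mf ∪ Mg ∪ (f + g).support, .add (hf.mono fun _ _ h => ?_) (hg.mono fun _ _ h => ?_) ?_⟩
    · exact h.trans (Finset.subset_union_left.trans Finset.subset_union_left)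
    · exact h.trans (Finset.subset_union_right.trans Finset.subset_union_left)
    · exact Finset.subset_union_right
  | @smul f a _ _ ih =>
    obtain ⟨Mf, hf⟩ := ih
    refine ⟨Mf ∪ (a • f).support, .smul a (hf.mono fun _ _ h => h.trans Finset.subset_union_left) ?_⟩
    exact Finset.subset_union_right
  | @mulVar f j _ _ ih =>
    obtain ⟨Mf, hf⟩ := ih
    refine ⟨Mf ∪ (ml K (X j * f)).support,
      .mulVar j (hf.mono fun _ _ h => h.trans Finset.subset_union_left) ?_⟩
    exact Finset.subset_union_right

variable [DecidableEq σ]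

/-- **Restriction is evaluation at the updated point**:
`g|_{x_j:=b} (x) = g (x[j ↦ b])` on Boolean points. [folklore] -/
theorem eval_restrictVar (x : σ → Bool) (j : σ) (b : Bool) (g : MvPolynomial σ K) :
    eval (boolPoint K x) (restrictVar K j b g) = eval (boolPoint K (Function.update x j b)) g := by
  rw [restrictVar]
  change eval₂Hom (RingHom.id K) _ (bind₁ _ g) = eval₂Hom (RingHom.id K) _ g
  rw [eval₂Hom_bind₁]
  congr 2
  funext i
  by_cases hij : i = j
  · subst hij
    simp only [if_true, Function.update_self, boolPoint]
    cases b <;> simp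
  · rw [if_neg hij]
    simp [boolPoint, Function.update_of_ne hij]

/-- Restriction preserves Boolean unsatisfiability. [folklore] -/
theorem BoolUnsat.restrictSet (h : BoolUnsat K 𝓕) (j : σ) (b : Bool) :
    BoolUnsat K (restrictSet j b 𝓕) := by
  intro x
  obtain ⟨g, hg, hne⟩ := h (Function.update x j b)
  exact ⟨restrictVar K j b g, ⟨g, hg, rfl⟩, by rwa [eval_restrictVar]⟩

/-- The restricted variable no longer occurs. [folklore] -/
theorem notMem_vars_restrictVar (j : σ) (b : Bool) (g : MvPolynomial σ K) :
    j ∉ (restrictVar K j b g).vars := by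
  intro hj
  rw [restrictVar] at hj
  obtain ⟨i, _, hi⟩ := mem_vars_bind₁ _ _ hj
  by_cases hij : i = j
  · rw [if_pos hij] at hi
    cases b
    · simp at hi
    · simp at hi
  · rw [if_neg hij, vars_X, Finset.mem_singleton] at hi
    exact hij hi.symm

/-- A polynomial without variables is a constant. [folklore] -/
theorem eq_C_of_vars_subset_empty {g : MvPolynomial σ K} (h : g.vars ⊆ ∅) : g = C (coeff 0 g) := by
  have hdeg : g.degrees = 0 := by
    rw [← Multiset.toFinset_eq_empty, ← vars_def]
    exact Finset.subset_empty.1 h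
  have htot : g.totalDegree = 0 := by
    have := totalDegree_le_degrees_card g
    rw [hdeg, Multiset.card_zero] at this
    omega
  exact totalDegree_eq_zero_iff_eq_C.1 htot

/-! ### Completeness -/

/-- **Completeness of the multilinear polynomial calculus (with a degree bound).**  If the axioms
`𝓕` live on the finite set `V` of variables, have degree `≤ d₀`, and have no common Boolean zero,
then `𝓕` has a refutation all of whose lines have degree `≤ |V| + d₀`.  (Induction on `V`: both
restrictions `𝓕|_{x_j:=0}`, `𝓕|_{x_j:=1}` are refutable by induction, and the two combination
lemmas of `PolynomialCalculusSizeDegreeCombine.lean` recombine them.) [Krajíček 2019, §6.2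
(Lemma 6.2.1, Thm. 6.2.2: completeness of PC); Clegg–Edmonds–Impagliazzo 1996]
[cite: KrajicekProofComplexity2019, §6.2] -/
theorem derivable_one_of_boolUnsat (d₀ : ℕ) :
    ∀ (V : Finset σ) (𝓕 : Set (MvPolynomial σ K)), (∀ g ∈ 𝓕, g.vars ⊆ V) →
      (∀ g ∈ 𝓕, g.totalDegree ≤ d₀) → BoolUnsat K 𝓕 →
      Derivable 𝓕 (fun g => g.totalDegree ≤ V.card + d₀) 1 := by
  intro V
  induction V using Finset.induction_on with
  | empty =>
    intro 𝓕 hV _ hU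
    obtain ⟨g, hg, hne⟩ := hU fun _ => false
    have hgC : g = C (coeff 0 g) := eq_C_of_vars_subset_empty (hV g hg)
    set c := coeff 0 g with hc
    have hc0 : c ≠ 0 := by
      rw [hgC, eval_C] at hne; exact hne
    have hml : ml K g = C c := by rw [hgC, ml_C]
    have h1 : Derivable 𝓕 (fun g => g.totalDegree ≤ (∅ : Finset σ).card + d₀) (ml K g) :=
      .hyp hg (by rw [hml, totalDegree_C]; exact Nat.zero_le _)
    rw [hml] at h1
    have h2 := Derivable.smul c⁻¹ h1 (by
      rw [Finset.card_empty, zero_add]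
      refine (totalDegree_smul_le _ _).trans ?_
      rw [totalDegree_C]; exact Nat.zero_le _)
    rwa [← C_mul', ← C_mul, inv_mul_cancel₀ hc0, C_1] at h2
  | insert j W hjW ih =>
    intro 𝓕 hV h0 hU
    have hvars : ∀ b : Bool, ∀ g ∈ restrictSet j b 𝓕, g.vars ⊆ W := by
      rintro b g ⟨g', hg', rfl⟩ i hi
      have hiV := (vars_restrictVar_subset j b g').trans (hV g' hg') hi
      rcases Finset.mem_insert.1 hiV with rfl | hiW
      · exact absurd hi (notMem_vars_restrictVar _ b g')
      · exact hiW
    have hdeg : ∀ b : Bool, ∀ g ∈ restrictSet j b 𝓕, g.totalDegree ≤ d₀ :=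
      fun b g hg => totalDegree_le_of_mem_restrictSet h0 hg
    have h₀ := ih _ (hvars false) (hdeg false) (hU.restrictSet j false)
    have h₁ := ih _ (hvars true) (hdeg true) (hU.restrictSet j true)
    have hX := derivable_one_sub_X_of_restrict_false j h0 h₀
    have hcard : (insert j W).card = W.card + 1 := Finset.card_insert_of_notMem hjW
    exact (derivable_of_restrict_true j h0 hX h₁).mono fun g _ hg => hg.trans (by rw [hcard]; omega)

/-- **Existence of refutations with finitely many monomials**: a Boolean-unsatisfiable axiom set
on finitely many variables with bounded degrees has, for some finite set `M` of monomials, a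
refutation all of whose monomials lie in `M`. [Krajíček 2019, §6.2] [folklore] -/
theorem exists_derivable_one_support_subset {V : Finset σ} {d₀ : ℕ}
    (hV : ∀ g ∈ 𝓕, g.vars ⊆ V) (h0 : ∀ g ∈ 𝓕, g.totalDegree ≤ d₀) (hU : BoolUnsat K 𝓕) :
    ∃ M : Finset (σ →₀ ℕ), Derivable 𝓕 (fun g => g.support ⊆ M) 1 :=
  (derivable_one_of_boolUnsat d₀ V 𝓕 hV h0 hU).exists_support_subset

end MLPC

end Literature.Computability.MetaComplexity
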